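import Summits.ResolutionOfSingularities.KangarooAtlas.MizutaniPTower
import Literature.AlgebraicGeometry.Resolution.HironakaGroupScheme
import HarnessLib

/-!
# Mizutani's conjecture `m(e) = 2p^e − 1` — Frobenius and the Hasse–Schmidt operators of a `p`-basis

Cell topic `Summits/ResolutionOfSingularities/KangarooAtlas` (pub-rosobs); namespace
`Summit.ResolutionOfSingularities.KangarooAtlas.Mizutani`.  Part of the Lean transcription of the
in-house note MIZUTANI-PROOF-g59 (AI-written, AI-audited; *AI review is weaker than expert review*; not a
resolution theorem); §3 dictionary, step 2.  For a tower `IsPTower L k (p^e) x a` (box monomials `a^W` an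
`L`-basis of `k`, `a_i^{p^e} ∈ L`; `MizutaniPTower`) in characteristic `p`, the base-`p` DIGIT CALCULUS of the
Hasse–Schmidt operators `D^{(T)} = hsD T`:

* Lucas on multiples of `p`: `C(pN, T) ≡ 0` unless `p ∣ T`, and `C(pN, pS) ≡ C(N, S)`;
* `hsD_pow_p_eq_zero`: `D^{(T)}(y^p) = 0` if some `T_i` is not divisible by `p`;
  `hsD_nsmul_pow_p`: `D^{(pS)}(y^p) = (D^{(S)} y)^p`;
* `hsD_pow_p_mul` (`r < p`): `D^{(r)}(y^p z) = y^p D^{(r)} z`; `hsD_nsmul_pmon_mul_pow` (`U < p`):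
  `D^{(pS)}(a^U y^p) = a^U (D^{(S)} y)^p`; `hsD_hsD_nsmul` : `D^{(r)} D^{(pS)} = D^{(pS + r)}`;
* `hsD_pow_pow_eq_zero` / `hsD_pow_pow_mul`: `D^{(T)}` is `k^{p^{e'}}`-linear for `T < p^{e'}`, `e' ≤ e`;
* `isDiffOpLE_hsD`: `D^{(T)}` is a differential operator of `k` over `L` of order `≤ |T|` (EGA IV 16.8.8 (b)
  by the Leibniz rule, as in `HasseSchmidtDerivatives.isDiffOpLE_hasseDeriv`);
* `hsD_eq_of_level_le`: the operators of the towers `k ⊃ k^{p^e}` and `k ⊃ k^{p^{e'}}` (`e' ≤ e`) on the same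
  `p`-basis agree for `T < p^{e'}`.

References: [Mizutani1973HironakaGroupSchemes] (Remark 2.10; in-house proof §1.4, §3);
[Oda1983HironakaGroupSchemeII] §1–§2 (p. 1166–1168); [EGAIV4] Thm. 16.11.2, Prop. 16.8.8.
-/

open MvPolynomial Literature.AlgebraicGeometry.Resolution
  Literature.AlgebraicGeometry.Resolution.HironakaScheme

namespace Summit.ResolutionOfSingularities.KangarooAtlas.Mizutani

section Frobenius

variable {ι : Type*} {L k : Type*} [Field L] [Field k] [Algebra L k] {p e : ℕ} [hp : Fact p.Prime]
  [CharP L p] [CharP k p] {x : ι → L} {a : ι → k}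

/-! ### Lucas on multiples of `p` -/

omit [Field k] [Algebra L k] [CharP k p] in
/-- `C(pn, t) ≡ 0 (mod p)` if `p ∤ t`, and `C(pn, ps) ≡ C(n, s)`: one-step Lucas. [folklore] -/
theorem natCast_choose_mul_left (n t : ℕ) :
    (((p * n).choose t : ℕ) : L) = if p ∣ t then (((n.choose (t / p)) : ℕ) : L) else 0 := by
  have h := Choose.choose_modEq_choose_mod_mul_choose_div_nat (n := p * n) (k := t) (p := p)
  rw [Nat.mul_mod_right, Nat.mul_div_cancel_left _ hp.out.pos] at h
  rw [CharP.natCast_eq_natCast' L p h]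
  split_ifs with hdvd
  · rw [Nat.mod_eq_zero_of_dvd hdvd, Nat.choose_zero_right, one_mul]
  · have : t % p ≠ 0 := fun h0 => hdvd (Nat.dvd_of_mod_eq_zero h0)
    rw [Nat.choose_eq_zero_of_lt (Nat.pos_of_ne_zero this), zero_mul, Nat.cast_zero]

omit [Field k] [Algebra L k] [CharP k p] in
/-- `C(pN, T) = 0` in characteristic `p` as soon as some `T_i` is not a multiple of `p`. [folklore] -/
theorem natCast_mchoose_nsmul_eq_zero (N T : ι →₀ ℕ) {i : ι} (hi : ¬ p ∣ T i) :
    (mchoose (p • N) T : L) = 0 := by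
  unfold mchoose
  rw [Nat.cast_prod]
  have hiT : i ∈ T.support := by
    rw [Finsupp.mem_support_iff]; intro h0; exact hi (h0 ▸ dvd_zero p)
  refine Finset.prod_eq_zero hiT ?_
  rw [Finsupp.smul_apply, smul_eq_mul, natCast_choose_mul_left, if_neg hi]

omit [Field k] [Algebra L k] [CharP k p] in
/-- `C(pN, pS) = C(N, S)` in characteristic `p`. [folklore] -/
theorem natCast_mchoose_nsmul_nsmul (N S : ι →₀ ℕ) : (mchoose (p • N) (p • S) : L) = (mchoose N S : L) := by
  unfold mchoose
  rw [Finsupp.support_smul_eq hp.out.ne_zero, Nat.cast_prod, Nat.cast_prod]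
  refine Finset.prod_congr rfl fun i _ => ?_
  rw [Finsupp.smul_apply, Finsupp.smul_apply, smul_eq_mul, smul_eq_mul, natCast_choose_mul_left,
    if_pos (dvd_mul_right p _), Nat.mul_div_cancel_left _ hp.out.pos]

omit [Field k] [Algebra L k] [CharP k p] in
/-- `C(pS + r, r) = 1` in characteristic `p` for `r < p` (digitwise `r ≤ pS + r`). [folklore] -/
theorem natCast_mchoose_nsmul_add_self (S r : ι →₀ ℕ) (hr : InBox p r) :
    (mchoose (p • S + r) r : L) = 1 := by
  unfold mchoose
  rw [Nat.cast_prod]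
  refine Finset.prod_eq_one fun i _ => ?_
  rw [Finsupp.add_apply, Finsupp.smul_apply, smul_eq_mul, natCast_choose_eq_choose_mod_pow L 1 (by
    rw [pow_one]; exact hr i), pow_one, Nat.mul_add_mod, Nat.mod_eq_of_lt (hr i), Nat.choose_self, Nat.cast_one]

/-! ### Values on `p`-th powers -/

/-- Expansion of an element of `k` as an `L`-combination of monomials `a^N` (any polynomial representative).
[folklore] -/
theorem aeval_eq_sum_smul_pmon (f : MvPolynomial ι L) :
    aeval a f = ∑ N ∈ f.support, coeff N f • pmon a N := by
  conv_lhs => rw [f.as_sum]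
  rw [map_sum]
  exact Finset.sum_congr rfl fun N _ => aeval_monomial_eq_smul_pmon a N _

omit [CharP L p] in
/-- `(f(a))^p = Σ_N c_N^p a^{pN}`. [folklore] -/
theorem aeval_pow_p_eq_sum (f : MvPolynomial ι L) :
    aeval a f ^ p = ∑ N ∈ f.support, coeff N f ^ p • pmon a (p • N) := by
  rw [aeval_eq_sum_smul_pmon, sum_pow_char]
  exact Finset.sum_congr rfl fun N _ => by rw [smul_pow, pmon_nsmul]

/-- **`D^{(T)}(y^p) = 0` unless `p ∣ T`** (`T` in the box). [cite: Mizutani1973HironakaGroupSchemes, Remark 2.10 (in-house proof §3 (d), the split ideal I_S = (J^{[p]})^{q/p})] -/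
theorem IsPTower.hsD_pow_p_eq_zero (h : IsPTower L k (p ^ e) x a) {T : ι →₀ ℕ} (hT : InBox (p ^ e) T)
    {i : ι} (hi : ¬ p ∣ T i) (y : k) : h.hsD T (y ^ p) = 0 := by
  obtain ⟨f, rfl⟩ := h.aeval_surjective y
  rw [aeval_pow_p_eq_sum, map_sum]
  refine Finset.sum_eq_zero fun N _ => ?_
  rw [LinearMap.map_smul, h.hsD_pmon hT, natCast_mchoose_nsmul_eq_zero N T hi, zero_smul, smul_zero]

omit [Field L] [Field k] [Algebra L k] hp [CharP L p] [CharP k p] in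
/-- `p • N − p • S = p • (N − S)`. [folklore] -/
theorem nsmul_tsub_nsmul (N S : ι →₀ ℕ) : p • N - p • S = p • (N - S) := by
  ext i
  simp only [Finsupp.coe_tsub, Finsupp.coe_smul, Pi.sub_apply, Pi.smul_apply, smul_eq_mul]
  exact (Nat.mul_sub p (N i) (S i)).symm

/-- **`D^{(pS)}(y^p) = (D^{(S)} y)^p`** (`pS` in the box). [cite: Mizutani1973HironakaGroupSchemes, Remark 2.10 (in-house proof §3 (d): the Frobenius twist F ⊗ F)] -/
theorem IsPTower.hsD_nsmul_pow_p (h : IsPTower L k (p ^ e) x a) {S : ι →₀ ℕ} (hS : InBox (p ^ e) (p • S))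
    (y : k) : h.hsD (p • S) (y ^ p) = (h.hsD S y) ^ p := by
  have hS' : InBox (p ^ e) S := fun i => lt_of_le_of_lt (by
    rw [Finsupp.smul_apply, smul_eq_mul]; exact Nat.le_mul_of_pos_left _ hp.out.pos) (hS i)
  obtain ⟨f, rfl⟩ := h.aeval_surjective y
  rw [aeval_pow_p_eq_sum, map_sum, aeval_eq_sum_smul_pmon, map_sum, sum_pow_char]
  refine Finset.sum_congr rfl fun N _ => ?_
  rw [LinearMap.map_smul, LinearMap.map_smul, h.hsD_pmon hS, h.hsD_pmon hS', natCast_mchoose_nsmul_nsmul,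
    nsmul_tsub_nsmul, pmon_nsmul, smul_pow, smul_pow, ← frobenius_def (p := p) (mchoose N S : L),
    map_natCast]

/-- **`D^{(r)}(y^p z) = y^p D^{(r)} z` for `r < p`** (the operators `D^{(r)}`, `r` digitwise `< p`, are
`k^p`-linear). [cite: Oda1983HironakaGroupSchemeII, §2 (p. 1168: Diff_{p^e−1}(k) is over F^e(k))] -/
theorem IsPTower.hsD_pow_p_mul [DecidableEq ι] (h : IsPTower L k (p ^ e) x a) (he : 1 ≤ e) {r : ι →₀ ℕ}
    (hr : InBox p r) (y z : k) : h.hsD r (y ^ p * z) = y ^ p * h.hsD r z := by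
  have hr' : InBox (p ^ e) r := fun i => lt_of_lt_of_le (hr i) (by
    calc p = p ^ 1 := (pow_one p).symm
      _ ≤ p ^ e := Nat.pow_le_pow_right hp.out.pos he)
  rw [h.hsD_mul hr', Finset.sum_eq_single (0, r)]
  · rw [h.hsD_zero_apply]
  · rintro ⟨T₁, T₂⟩ hw hne
    have hw' : T₁ + T₂ = r := Finset.mem_antidiagonal.mp hw
    have hT₁ : T₁ ≠ 0 := by
      rintro rfl; apply hne; rw [zero_add] at hw'; rw [hw']
    obtain ⟨i, hi⟩ : ∃ i, T₁ i ≠ 0 := by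
      by_contra hc; push Not at hc; exact hT₁ (Finsupp.ext hc)
    have hlt : T₁ i < p := lt_of_le_of_lt (by rw [← hw']; exact Nat.le_add_right _ _) (hr i)
    have hndvd : ¬ p ∣ T₁ i := fun hd => hi (Nat.eq_zero_of_dvd_of_lt hd hlt)
    have hT₁box : InBox (p ^ e) T₁ := fun j => lt_of_le_of_lt (by rw [← hw']; exact Nat.le_add_right _ _) (hr' j)
    rw [h.hsD_pow_p_eq_zero hT₁box hndvd, zero_mul]
  · intro hn; exact absurd (Finset.mem_antidiagonal.mpr (zero_add r)) hn

/-- **`D^{(pS)}(a^U y^p) = a^U (D^{(S)} y)^p` for `U < p`** (`pS` in the box).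
[cite: Mizutani1973HironakaGroupSchemes, Remark 2.10 (in-house proof §3 (d))] -/
theorem IsPTower.hsD_nsmul_pmon_mul_pow [DecidableEq ι] (h : IsPTower L k (p ^ e) x a) {S U : ι →₀ ℕ}
    (hS : InBox (p ^ e) (p • S)) (hU : InBox p U) (y : k) :
    h.hsD (p • S) (pmon a U * y ^ p) = pmon a U * (h.hsD S y) ^ p := by
  rw [h.hsD_mul hS, Finset.sum_eq_single (0, p • S)]
  · rw [h.hsD_zero_apply, h.hsD_nsmul_pow_p hS]
  · rintro ⟨T₁, T₂⟩ hw hne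
    have hw' : T₁ + T₂ = p • S := Finset.mem_antidiagonal.mp hw
    have hT₁box : InBox (p ^ e) T₁ := fun j => lt_of_le_of_lt (by rw [← hw']; exact Nat.le_add_right _ _) (hS j)
    have hT₂box : InBox (p ^ e) T₂ := fun j => lt_of_le_of_lt (by rw [← hw']; exact Nat.le_add_left _ _) (hS j)
    by_cases hdvd : ∀ i, p ∣ T₂ i
    · -- then `p ∣ T₁`, and `T₁ ≤ U < p` forces `T₁ = 0`
      have hT₁ : T₁ ≠ 0 := by
        rintro rfl; apply hne; rw [zero_add] at hw'; rw [hw']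
      by_cases hle : T₁ ≤ U
      · exfalso
        obtain ⟨i, hi⟩ : ∃ i, T₁ i ≠ 0 := by
          by_contra hc; push Not at hc; exact hT₁ (Finsupp.ext hc)
        have h1 : p ∣ T₁ i := by
          have := congrArg (fun M : ι →₀ ℕ => M i) hw'
          simp only [Finsupp.coe_add, Pi.add_apply, Finsupp.coe_smul, Pi.smul_apply, smul_eq_mul] at this
          have h2 := hdvd i
          rw [show T₁ i = p * S i - T₂ i by omega]
          exact Nat.dvd_sub (dvd_mul_right p _) h2
        have h3 : T₁ i < p := lt_of_le_of_lt (hle i) (hU i)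
        exact hi (Nat.eq_zero_of_dvd_of_lt h1 h3)
      · rw [h.hsD_pmon hT₁box, mchoose_eq_zero_of_not_le hle, Nat.cast_zero, zero_smul, zero_mul]
    · push Not at hdvd
      obtain ⟨i, hi⟩ := hdvd
      rw [h.hsD_pow_p_eq_zero hT₂box hi, mul_zero]
  · intro hn; exact absurd (Finset.mem_antidiagonal.mpr (zero_add _)) hn

omit [CharP k p] in
/-- **`D^{(r)} D^{(pS)} = D^{(pS + r)}` for `r < p`** (iterativity; `C(pS + r, r) = 1`).
[cite: EGAIV4, Thm. 16.11.2 (iterativity of the D_p)] -/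
theorem IsPTower.hsD_hsD_nsmul (h : IsPTower L k (p ^ e) x a) {S r : ι →₀ ℕ} (hbox : InBox (p ^ e) (p • S + r))
    (hr : InBox p r) (y : k) : h.hsD r (h.hsD (p • S) y) = h.hsD (p • S + r) y := by
  have hbox' : InBox (p ^ e) (r + p • S) := by rw [add_comm]; exact hbox
  rw [h.hsD_hsD hbox', add_comm r, natCast_mchoose_nsmul_add_self S r hr, one_smul]

/-! ### Linearity over the subfields `k^{p^{e'}}`, `e' ≤ e` -/

/-- `D^{(T)}(z^{p^{e'}}) = 0` for `0 ≠ T < p^{e'}`, `e' ≤ e`. [cite: Oda1983HironakaGroupSchemeII, §1 (p. 1166: (a_γ)^λ for λ with p^e-denominators is F^{-e}-linear data)] -/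
theorem IsPTower.hsD_pow_pow_eq_zero (h : IsPTower L k (p ^ e) x a) :
    ∀ {e' : ℕ} (_ : e' ≤ e) {T : ι →₀ ℕ} (_ : InBox (p ^ e') T) (_ : T ≠ 0) (z : k), h.hsD T (z ^ p ^ e') = 0
  | 0, _, T, hT, hT0, z => by
    exfalso; apply hT0; ext i; have := hT i; rw [pow_zero] at this; simp only [Finsupp.coe_zero, Pi.zero_apply]; omega
  | e' + 1, he', T, hT, hT0, z => by
    have hTe : InBox (p ^ e) T := fun i => lt_of_lt_of_le (hT i) (Nat.pow_le_pow_right hp.out.pos he')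
    rw [pow_succ, pow_mul]
    by_cases hdvd : ∀ i, p ∣ T i
    · -- `T = p • S` with `S ≠ 0`, `S < p^{e'}`
      set S := divPart p T with hSdef
      have hTS : T = p • S := by
        ext i
        rw [Finsupp.smul_apply, smul_eq_mul, hSdef, divPart_apply, Nat.mul_div_cancel' (hdvd i)]
      have hS0 : S ≠ 0 := by
        intro h0; apply hT0; rw [hTS, h0, smul_zero]
      have hS : InBox (p ^ e') S := fun i => by
        have := hT i
        rw [hTS, Finsupp.smul_apply, smul_eq_mul, pow_succ'] at this
        exact Nat.lt_of_mul_lt_mul_left this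
      rw [hTS] at hTe ⊢
      rw [h.hsD_nsmul_pow_p hTe, h.hsD_pow_pow_eq_zero (Nat.le_of_succ_le he') hS hS0 z,
        zero_pow hp.out.ne_zero]
    · push Not at hdvd
      obtain ⟨i, hi⟩ := hdvd
      exact h.hsD_pow_p_eq_zero hTe hi _

/-- **`D^{(T)}(z^{p^{e'}} y) = z^{p^{e'}} D^{(T)} y` for `T < p^{e'}`, `e' ≤ e`**: the operators below level `e'`
are linear over `k^{p^{e'}}`. [cite: Oda1983HironakaGroupSchemeII, §2 (p. 1168: "hence necessarily over the subfield F^e(k)")] -/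
theorem IsPTower.hsD_pow_pow_mul [DecidableEq ι] (h : IsPTower L k (p ^ e) x a) {e' : ℕ} (he' : e' ≤ e)
    {T : ι →₀ ℕ} (hT : InBox (p ^ e') T) (z y : k) : h.hsD T (z ^ p ^ e' * y) = z ^ p ^ e' * h.hsD T y := by
  have hTe : InBox (p ^ e) T := fun i => lt_of_lt_of_le (hT i) (Nat.pow_le_pow_right hp.out.pos he')
  rw [h.hsD_mul hTe, Finset.sum_eq_single (0, T)]
  · rw [h.hsD_zero_apply]
  · rintro ⟨T₁, T₂⟩ hw hne
    have hw' : T₁ + T₂ = T := Finset.mem_antidiagonal.mp hw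
    have hT₁ : T₁ ≠ 0 := by
      rintro rfl; apply hne; rw [zero_add] at hw'; rw [hw']
    have hT₁box : InBox (p ^ e') T₁ := fun j => lt_of_le_of_lt (by rw [← hw']; exact Nat.le_add_right _ _) (hT j)
    rw [h.hsD_pow_pow_eq_zero he' hT₁box hT₁ z, zero_mul]
  · intro hn; exact absurd (Finset.mem_antidiagonal.mpr (zero_add T)) hn

/-! ### Order of the Hasse–Schmidt operators -/

omit [CharP k p] in
/-- The commutator of `D^{(T)}` with a multiplication is a combination of `D^{(T₂)}`, `T₂ < T` (Leibniz minus its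
first term). [cite: EGAIV4, Prop. 16.8.8 (b) with Thm. 16.11.2] -/
theorem IsPTower.commMul_hsD [DecidableEq ι] (h : IsPTower L k (p ^ e) x a) {T : ι →₀ ℕ} (hT : InBox (p ^ e) T)
    (g : k) : commMul L (h.hsD T) g =
      ∑ w ∈ (Finset.antidiagonal T).erase (0, T), h.hsD w.1 g • h.hsD w.2 := by
  refine LinearMap.ext fun t => ?_
  have h0 : ((0 : ι →₀ ℕ), T) ∈ Finset.antidiagonal T := by simp
  rw [commMul_apply, h.hsD_mul hT, ← Finset.add_sum_erase _ _ h0, LinearMap.sum_apply]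
  simp only [h.hsD_zero_apply, LinearMap.smul_apply, smul_eq_mul]
  ring

omit [CharP k p] in
/-- **`D^{(T)}` is a differential operator of `k` over `L` of order `≤ |T|`** (`T` in the box).
[cite: EGAIV4, Thm. 16.11.2 (the D_p, |p| ≤ m, lie in Diff^m)] -/
theorem IsPTower.isDiffOpLE_hsD [DecidableEq ι] (h : IsPTower L k (p ^ e) x a) :
    ∀ (n : ℕ) {T : ι →₀ ℕ} (_ : InBox (p ^ e) T) (_ : T.degree ≤ n), IsDiffOpLE L n (h.hsD T)
  | 0, T, hT, hdeg => by
    have : T = 0 := (Finsupp.degree_eq_zero_iff T).1 (Nat.le_zero.1 hdeg)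
    subst this
    intro g
    refine LinearMap.ext fun t => ?_
    rw [commMul_apply, h.hsD_zero_apply, h.hsD_zero_apply, LinearMap.zero_apply, sub_self]
  | n + 1, T, hT, hdeg => fun g => by
    rw [h.commMul_hsD hT]
    refine IsDiffOpLE.sum _ fun w hw => IsDiffOpLE.smul _ (h.isDiffOpLE_hsD n ?_ ?_)
    · have hw' : w.1 + w.2 = T := Finset.mem_antidiagonal.mp (Finset.mem_of_mem_erase hw)
      exact fun j => lt_of_le_of_lt (by rw [← hw']; exact Nat.le_add_left _ _) (hT j)
    · have := degree_snd_lt_of_mem_erase_antidiagonal hw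
      omega

/-! ### Two levels on the same `p`-basis -/

/-- **The operators do not depend on the level**: if `a` is a `p`-basis for `k ⊃ L` at level `e` and for
`k ⊃ k^{p^{e'}}` at level `e' ≤ e`, the two Hasse–Schmidt operators `D^{(T)}` agree for `T < p^{e'}`.
[cite: Oda1983HironakaGroupSchemeII, §1 (p. 1166–1167: the ∂_λ are defined on all of F^{-∞}(k), independently of e)] -/
theorem IsPTower.hsD_eq_of_level_le [DecidableEq ι] (h : IsPTower L k (p ^ e) x a) {e' : ℕ} (he' : e' ≤ e)
    {x' : ι → frobPow k p e'} (h' : IsPTower (frobPow k p e') k (p ^ e') x' a) {T : ι →₀ ℕ}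
    (hT : InBox (p ^ e') T) (y : k) : h'.hsD T y = h.hsD T y := by
  have hTe : InBox (p ^ e) T := fun i => lt_of_lt_of_le (hT i) (Nat.pow_le_pow_right hp.out.pos he')
  have hy : y ∈ Submodule.span (frobPow k p e') (Set.range fun W : BoxIdx ι (p ^ e') => pmon a W.1) := by
    rw [h'.span_eq_top]; trivial
  induction hy using Submodule.span_induction with
  | mem z hz =>
    obtain ⟨W, rfl⟩ := hz
    rw [h'.hsD_pmon hT, h.hsD_pmon hTe, Algebra.smul_def, Algebra.smul_def, map_natCast, map_natCast]
  | zero => rw [map_zero, map_zero]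
  | add z w _ _ hz hw => rw [map_add, map_add, hz, hw]
  | smul c z _ hz =>
    rw [LinearMap.map_smul, hz, Algebra.smul_def, Algebra.smul_def]
    obtain ⟨u, hu⟩ := (RingHom.mem_fieldRange).mp c.2
    rw [show algebraMap (frobPow k p e') k c = (c : k) from rfl, ← hu, iterateFrobenius_def,
      h.hsD_pow_pow_mul he' hT]

end Frobenius

end Summit.ResolutionOfSingularities.KangarooAtlas.Mizutani
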